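import Summits.QuantumFields.YangMills.Theorems.BalabanUVNodesN15TwoSpacingGluingCurvedKnitCovariantAveragingDefectRows
import HarnessLib

/-!
# N15 = NE2, road (c) — PROGRAMME (PC), (PC-F) «the per-cube KNIT», II: THE COVARIANT AVERAGING PERTURBATION IS LOCAL IN THE TRANSPORTERS — `N_V^Q(U)∘M_χ` reads `U` only on the
# blocks one coarse step around `supp χ`; hence n15-c∕`cv_hasMaj_sandwich_cvNVq` holds with BOX-LOCAL transporter letters (dag-n15-c g30, n15-c∕317)

Cell `pub-ymgap`, seat `pub-ymgap-dag-n15-c` (generation g30; R134 (a), s1; HUMAN RULING D-0062).  `bears_on: R4∕N15 · K3⁸ SpineGivenEndpointR13SepCoPHV (stmt-QuantumFields-27366)`;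
filed `--kind proof --supports stmt-QuantumFields-27366 --as helper` — COUNT-NEUTRAL.  Theorems only, 0 `def`, 0 `sorry`; kernel bookkeeping, no estimate of Bałaban's.  Imports BY NAME
n15-c∕`…CovariantAveragingDefectRows` (`cv_hasMaj_sandwich_cvNVq`; through it n15-c∕181∕183 `cvT`, `cvNVq`, `CvX`, `CvNorm`, the (P-Q) objects `qvKer`∕`qvAdjKer`∕`qvCov`∕`qvCovAdj`∕`cvaPath`∕
`cvaStair`∕`cvaLine`, dag-n15-a's `blockOf_add_smul_unitVec_of_le`, `kingBlockOf_bpt`, `bpt_blockCoords`).  Nothing in the tree is modified.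

WHY ((PC-F), HOME HANDOFF §g29 RECIPE (3)).  The knit n15-c∕202∕203 asks the near∕far rows of `N_V k = (N_V^Q + N_V^R)(U^{u_k})` behind the INPUT CUT `χ_k`.  For the `R`-part n15-c∕315
delivers them from the per-cube (3.35) datum.  For the `Q`-part the tree's row lemma `cv_hasMaj_sandwich_cvNVq` (n15-c∕182b `hasMaj_nvQ` sandwiched) wants the transporter letters
`rows∕cols(coordMat e Ad_{U_μ(p)} − 1) ≤ ρ` at EVERY bond point — but a field in the PER-CUBE class (3.35) is small only in the cube's own gauge on the cube's box.  The averaging words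
are local ([Balaban1985BackgroundPropagators] Cor. 3.8 p. 410: *«G(□) depends on U restricted to □̃»*; here trivially so: `Q(U)` of (125) transports along contours inside one block and
one block further in the averaging direction): `cvaPath T (x, κ) s` (`s ≤ n`) reads `T` at bond points of the blocks `B(x)` and `B(x) + e_κ` ONLY (§1), so `Q_T∘M_χ` and
`Q*_T∘Q_T∘M_χ` depend on `T` only one coarse step around the blocks met by `supp χ` (§2), and the GLOBAL lemma applied to the field EXTENDED BY `𝟙` off that neighbourhood gives the
row with box-local letters (§3) — the shape the assembly n15-c∕318∕319 feeds with dag-n15-w2's (3.35) letters on the cube's box.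

WHAT.  §1 `blockCoords_fst`, ★ `cvaPath_congr_of_blockOf` (locality of the (125) transport in `T`).  §2 `qvKer_mulOp_apply_eq_zero` (a coarse bond `(y, κ)` two coarse steps away from
`supp χ` receives nothing), `qvCov_comp_mulOp_congr`, `qvCovAdj_apply_congr`, ★★ `qvCovAdj_comp_qvCov_comp_mulOp_congr` (`Q*_T∘Q_T∘M_χ = Q*_{T′}∘Q_{T′}∘M_χ` when `T = T′` on the
one-step neighbourhood `S′` of the blocks `S ⊇ B(supp χ)`).  §3 `cvNVq_comp_mulOp_congr`, ★★★ `cv_hasMaj_sandwich_cvNVq_local`: for cuts `|f|, |χ| ≤ 1` with `B(supp χ) ⊆ S` and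
`S ∪ (S ± e_κ) ⊆ S′` stepwise (`hS′`), IF `rows∕cols(cvT e U − 1) ≤ ρ` at the bond points whose block lies in `S′`, THEN `M_f∘N_V^Q(U)∘M_χ ≤ |a|K(2+K)·c_δe^{3δ}·e^{−δd}`,
`K = (1+ρ)^{(d+2)L^k} − 1` — the constant of the global lemma, no letter outside `S′`.

HONEST FRAMING ∕ LIMITS.  Bookkeeping on the MODEL carriers of n15-c∕181 (doubled-torus cover, `Q(U)` = main term (125) of [B7] (124), one-level staircases); [B9] (3.26) p.395,
(3.59)–(3.60) p.402, Cor. 3.8 p.410 and [B-PI] (1.18) p.20 cited for SHAPES ∕ MECHANISM only.  NE2⁺ NOT PRINTED, NOT proved; N15 of record untouched (DISCHARGED AS CONSUMED, p687738);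
K3⁸ OPEN; counts UNMOVED (typed 28∕28); one finite 𝕋⁴ at fixed ε per index — NOT infinite volume, NOT OS on ℝ⁴, NOT a mass gap, NOT Clay.  Restate-immune (no Theses import).
-/

noncomputable section

open scoped BigOperators Matrix
open Finset

namespace Summit.QuantumFields.YangMills.BalabanUVNodes.N15.CovAvg

open Literature.MathematicalPhysics.QuantumFieldTheory.Balaban1983to89
open Literature.MathematicalPhysics.QuantumFieldTheory.Balaban1983to89.B5Prop11Plancherel (Tor fine unitVec)
open Literature.MathematicalPhysics.QuantumFieldTheory.Balaban1983to89.B6Prop26Gluing (mulOp mulOp_apply)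
open Literature.MathematicalPhysics.QuantumFieldTheory.Balaban1983to89.T4EtaRateCoeffDefect (fibre mem_fibre)
open Literature.MathematicalPhysics.QuantumFieldTheory.King1986.Torus (blockOf)
open Summit.QuantumFields.YangMills.BalabanUVNodes.N15.VectorPiece (bondAt blockCoords bpt_blockCoords)
open Summit.QuantumFields.YangMills.BalabanUVNodes.N15.TwoGrid (blockOf_add_smul_unitVec_of_le)
open Summit.QuantumFields.YangMills.BalabanUVNodes.N15.DefectKernel (kingBlockOf_bpt)

variable {d : ℕ}

/-! ## §1 The transport of (125) reads two blocks -/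

section Path

variable (M : Fin (d + 1) → ℕ) [∀ μ, NeZero (M μ)] (n : ℕ) [NeZero n] {ι : Type} [Fintype ι] [DecidableEq ι]

/-- the block of a fine point is the first block coordinate: `(blockCoords x).1 = B(x)`. [cite: Balaban1984PropagatorsI, (1.6) p.18 (shape)] -/
theorem blockCoords_fst (x : Tor (fine n M)) : (blockCoords n M x).1 = blockOf n M x := by
  conv_rhs => rw [← bpt_blockCoords n M x]
  rw [kingBlockOf_bpt]

/-- ★ **THE TRANSPORT OF (125) IS LOCAL IN THE TRANSPORTERS**: `cvaPath T (x, κ) s` (`s ≤ n`) reads `T` only at bond points of the blocks `B(x)` (the staircase from the base point, the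
start of the line) and `B(x) + e_κ` (the line `x + t e_κ`, `t < s ≤ n`, leaves `B(x)` by at most one coarse step). [cite: Balaban1985Averaging, (125) p.36; Balaban1984PropagatorsI, (1.18) p.20 (shape)] -/
theorem cvaPath_congr_of_blockOf {T T' : Fin (d + 1) → Tor (fine n M) × Fin (d + 1) → Matrix ι ι ℝ} {x : Tor (fine n M)} {κ : Fin (d + 1)}
    (h : ∀ μ (p : Tor (fine n M) × Fin (d + 1)), blockOf n M p.1 = blockOf n M x ∨ blockOf n M p.1 = blockOf n M x + unitVec M κ → T μ p = T' μ p) {s : ℕ} (hs : s ≤ n) :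
    cvaPath M n T (x, κ) s = cvaPath M n T' (x, κ) s := by
  rw [cvaPath, cvaPath]
  congr 1
  · -- the staircase: bonds of the block `B(x)` only
    unfold cvaStair
    refine mprod_congr fun i hi => ?_
    rw [dif_pos hi, dif_pos hi]
    unfold cvaLeg
    refine mprod_congr fun t _ => h _ _ (Or.inl ?_)
    simp only [bondAt, kingBlockOf_bpt, blockCoords_fst]
  · -- the line: bonds of `B(x)` or `B(x) + e_κ`
    unfold cvaLine
    refine mprod_congr fun t ht => h _ _ ?_
    obtain ⟨δ, hδ, hb⟩ := blockOf_add_smul_unitVec_of_le M n x κ (show t ≤ n by omega)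
    interval_cases δ
    · left; rw [hb, zero_smul, add_zero]
    · right; rw [hb, one_smul]

end Path

/-! ## §2 `Q_T∘M_χ` and `Q*_T∘Q_T∘M_χ` read the transporters one coarse step around `supp χ` -/

section Average

variable (M : Fin (d + 1) → ℕ) [∀ μ, NeZero (M μ)] (n : ℕ) [NeZero n] {ι : Type} [Fintype ι] [DecidableEq ι]

omit [DecidableEq ι] in
/-- a coarse bond `(y, κ)` with NEITHER `y` NOR `y + e_κ` among the blocks `S ⊇ B(supp χ)` receives nothing from `M_χ`: `(Q_W M_χ f)((y, κ), i) = 0` for every path kernel `W`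
(the fine bonds `x + s e_κ`, `x ∈ B(y)`, `s < n`, lie in `B(y) ∪ B(y + e_κ)`). [cite: Balaban1984PropagatorsI, (1.18) p.20 (shape)] -/
theorem qvKer_mulOp_apply_eq_zero (W : Tor (fine n M) × Fin (d + 1) → ℕ → Matrix ι ι ℝ) {χ : Tor (fine n M) × Fin (d + 1) → ℝ} {S : Finset (Tor M)}
    (hχS : ∀ p, χ p ≠ 0 → blockOf n M p.1 ∈ S) {y : Tor M} {κ : Fin (d + 1)} (hy : y ∉ S) (hy' : y + unitVec M κ ∉ S)
    (f : (Tor (fine n M) × Fin (d + 1)) × ι → ℝ) (i : ι) :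
    qvKer M n W (mulOp (fun q : (Tor (fine n M) × Fin (d + 1)) × ι => χ q.1) f) ((y, κ), i) = 0 := by
  rw [qvKer_apply]
  refine mul_eq_zero_of_right _ (sum_eq_zero fun x hx => mul_eq_zero_of_right _ (sum_eq_zero fun s hs => sum_eq_zero fun j _ => ?_))
  have hxy : blockOf n M x = y := (mem_fibre _ _ _).mp hx
  obtain ⟨δ, hδ, hb⟩ := blockOf_add_smul_unitVec_of_le M n x κ (mem_range.mp hs).le
  have hχ : χ (x + s • unitVec (fine n M) κ, κ) = 0 := by
    by_contra hne
    have hmem := hχS _ hne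
    dsimp only at hmem
    rw [hb, hxy] at hmem
    interval_cases δ
    · rw [zero_smul, add_zero] at hmem; exact hy hmem
    · rw [one_smul] at hmem; exact hy' hmem
  rw [mulOp_apply, hχ, zero_mul, mul_zero]

/-- `Q_T∘M_χ = Q_{T′}∘M_χ` when `T = T′` at the bond points whose block lies in `S′ ⊇ S ∪ (S − e_κ) ∪ (S + e_κ)` (stepwise: `hS′`), `S ⊇ B(supp χ)`.
[cite: Balaban1985BackgroundPropagators, Cor. 3.8 p.410 (locality in U: mechanism); Balaban1984PropagatorsI, (1.18) p.20 (shape)] -/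
theorem qvCov_comp_mulOp_congr {T T' : Fin (d + 1) → Tor (fine n M) × Fin (d + 1) → Matrix ι ι ℝ} {χ : Tor (fine n M) × Fin (d + 1) → ℝ} {S S' : Finset (Tor M)}
    (hχS : ∀ p, χ p ≠ 0 → blockOf n M p.1 ∈ S) (hS' : ∀ y κ, (y ∈ S ∨ y + unitVec M κ ∈ S) → y ∈ S' ∧ y + unitVec M κ ∈ S')
    (hTT' : ∀ μ (p : Tor (fine n M) × Fin (d + 1)), blockOf n M p.1 ∈ S' → T μ p = T' μ p) :
    qvCov M n T ∘ₗ mulOp (fun q : (Tor (fine n M) × Fin (d + 1)) × ι => χ q.1) = qvCov M n T' ∘ₗ mulOp (fun q : (Tor (fine n M) × Fin (d + 1)) × ι => χ q.1) := by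
  refine LinearMap.ext fun f => funext fun q => ?_
  obtain ⟨⟨y, κ⟩, i⟩ := q
  rw [LinearMap.comp_apply, LinearMap.comp_apply]
  by_cases hnear : y ∈ S ∨ y + unitVec M κ ∈ S
  · obtain ⟨h0, h1⟩ := hS' y κ hnear
    rw [qvCov_apply, qvCov_apply]
    refine congrArg _ (sum_congr rfl fun x hx => congrArg _ (sum_congr rfl fun s hs => sum_congr rfl fun j _ => ?_))
    have hxy : blockOf n M x = y := (mem_fibre _ _ _).mp hx
    rw [cvaPath_congr_of_blockOf M n (T := T) (T' := T') (fun μ p hp => hTT' μ p ?_) (mem_range.mp hs).le]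
    rw [hxy] at hp
    rcases hp with hp | hp
    · rw [hp]; exact h0
    · rw [hp]; exact h1
  · push Not at hnear
    rw [qvCov, qvCov, qvKer_mulOp_apply_eq_zero M n _ hχS hnear.1 hnear.2, qvKer_mulOp_apply_eq_zero M n _ hχS hnear.1 hnear.2]

/-- `Q*_T v = Q*_{T′} v` for coarse bond functions `v` vanishing at the bonds `(y, κ)` with neither `y` nor `y + e_κ` in `S`, when `T = T′` on `S′` as above (the fine point `x′`
receives from `B(x′ − s e_κ)` through `cvaPath T (x′ − s e_κ, κ) s`). [cite: Balaban1984PropagatorsI, (1.18) p.20, (1.69) p.29 («Q*»: shape)] -/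
theorem qvCovAdj_apply_congr {T T' : Fin (d + 1) → Tor (fine n M) × Fin (d + 1) → Matrix ι ι ℝ} {S S' : Finset (Tor M)}
    (hS' : ∀ y κ, (y ∈ S ∨ y + unitVec M κ ∈ S) → y ∈ S' ∧ y + unitVec M κ ∈ S')
    (hTT' : ∀ μ (p : Tor (fine n M) × Fin (d + 1)), blockOf n M p.1 ∈ S' → T μ p = T' μ p) {v : (Tor M × Fin (d + 1)) × ι → ℝ}
    (hv : ∀ y κ i, ¬ (y ∈ S ∨ y + unitVec M κ ∈ S) → v ((y, κ), i) = 0) : qvCovAdj M n T v = qvCovAdj M n T' v := by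
  funext p
  obtain ⟨⟨x', κ⟩, j⟩ := p
  rw [qvCovAdj_apply, qvCovAdj_apply]
  refine congrArg _ (sum_congr rfl fun s hs => sum_congr rfl fun i _ => ?_)
  dsimp only
  by_cases hnear : blockOf n M (x' - s • unitVec (fine n M) κ) ∈ S ∨ blockOf n M (x' - s • unitVec (fine n M) κ) + unitVec M κ ∈ S
  · obtain ⟨h0, h1⟩ := hS' _ κ hnear
    rw [cvaPath_congr_of_blockOf M n (T := T) (T' := T') (x := x' - s • unitVec (fine n M) κ) (κ := κ) (fun μ p hp => hTT' μ p ?_) (mem_range.mp hs).le]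
    rcases hp with hp | hp
    · rw [hp]; exact h0
    · rw [hp]; exact h1
  · rw [hv _ _ _ hnear, mul_zero, mul_zero]

/-- ★★ **`Q*_T∘Q_T∘M_χ = Q*_{T′}∘Q_{T′}∘M_χ`** when `T = T′` at the bond points whose block lies in `S′`, `S ∪ (S ± e_κ) ⊆ S′` stepwise, `S ⊇ B(supp χ)`: the covariant averaging word
behind a cut reads the transporters one coarse step around the cut. [cite: Balaban1985BackgroundPropagators, (3.59)–(3.60) p.402, Cor. 3.8 p.410 (locality in U: mechanism)] -/
theorem qvCovAdj_comp_qvCov_comp_mulOp_congr {T T' : Fin (d + 1) → Tor (fine n M) × Fin (d + 1) → Matrix ι ι ℝ} {χ : Tor (fine n M) × Fin (d + 1) → ℝ} {S S' : Finset (Tor M)}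
    (hχS : ∀ p, χ p ≠ 0 → blockOf n M p.1 ∈ S) (hS' : ∀ y κ, (y ∈ S ∨ y + unitVec M κ ∈ S) → y ∈ S' ∧ y + unitVec M κ ∈ S')
    (hTT' : ∀ μ (p : Tor (fine n M) × Fin (d + 1)), blockOf n M p.1 ∈ S' → T μ p = T' μ p) :
    (qvCovAdj M n T ∘ₗ qvCov M n T) ∘ₗ mulOp (fun q : (Tor (fine n M) × Fin (d + 1)) × ι => χ q.1) =
      (qvCovAdj M n T' ∘ₗ qvCov M n T') ∘ₗ mulOp (fun q : (Tor (fine n M) × Fin (d + 1)) × ι => χ q.1) := by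
  refine LinearMap.ext fun f => ?_
  rw [LinearMap.comp_apply, LinearMap.comp_apply, LinearMap.comp_apply, LinearMap.comp_apply]
  have hQ : qvCov M n T (mulOp (fun q : (Tor (fine n M) × Fin (d + 1)) × ι => χ q.1) f) = qvCov M n T' (mulOp (fun q : (Tor (fine n M) × Fin (d + 1)) × ι => χ q.1) f) := by
    have h := LinearMap.congr_fun (qvCov_comp_mulOp_congr M n (ι := ι) (T := T) (T' := T') hχS hS' hTT') f
    rwa [LinearMap.comp_apply, LinearMap.comp_apply] at h
  rw [hQ]
  exact qvCovAdj_apply_congr M n hS' hTT' fun y κ i hfar => by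
    push Not at hfar
    exact qvKer_mulOp_apply_eq_zero M n _ hχS hfar.1 hfar.2 f i

end Average

end Summit.QuantumFields.YangMills.BalabanUVNodes.N15.CovAvg

/-! ## §3 The row of `N_V^Q` behind a cut from BOX-LOCAL transporter letters -/

namespace Summit.QuantumFields.YangMills.BalabanUVNodes.N15.Gluing

open Real
open Literature.MathematicalPhysics.QuantumFieldTheory.Balaban1983to89
open Literature.MathematicalPhysics.QuantumFieldTheory.Balaban1983to89.B11SectG (BlockNorm HasMaj)
open Literature.MathematicalPhysics.QuantumFieldTheory.Balaban1983to89.B6Prop26Gluing (mulOp mulOp_apply)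
open Literature.MathematicalPhysics.QuantumFieldTheory.Balaban1983to89.B6UnitTorusCarrier (unitTorusGeo)
open Literature.MathematicalPhysics.QuantumFieldTheory.Balaban1983to89.B5Prop11Plancherel (Tor fine unitVec)
open Literature.MathematicalPhysics.QuantumFieldTheory.King1986.Torus (blockOf)
open Summit.QuantumFields.YangMills.BalabanUVNodes.N15.VectorPiece (tensorId)
open Summit.QuantumFields.YangMills.BalabanUVNodes.N15.TwoGrid (qvRe qvAdjRe)
open Summit.QuantumFields.YangMills.BalabanUVNodes.N15.CovAvg (qvCov qvCovAdj qvCovAdj_comp_qvCov_comp_mulOp_congr)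

variable {d : ℕ}

section Local

open scoped Matrix.Norms.L2Operator

variable {L : ℕ} [NeZero L] {mm : Type} [Fintype mm] [DecidableEq mm] {ι : Type} [Fintype ι] [DecidableEq ι] (e : Matrix mm mm ℂ ≃L[ℝ] (ι → ℝ))
variable (mv kk : ℕ) (hL : Odd L ∧ 1 < L) (a : ℝ)

/-- `N_V^Q(U)∘M_χ = N_V^Q(U′)∘M_χ` when `U = U′` at the bond points whose block lies in `S′` (`S ∪ (S ± e_κ) ⊆ S′` stepwise, `S ⊇ B(supp χ)`).
[cite: Balaban1985BackgroundPropagators, (3.59)–(3.60) p.402, Cor. 3.8 p.410 (locality in U: mechanism)] -/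
theorem cvNVq_comp_mulOp_congr {U U' : Fin (d + 1) → CvX d L mv kk hL → Matrix mm mm ℂ} {χ : CvX d L mv kk hL → ℝ} {S S' : Finset (Tor (cvM d L mv kk hL))}
    (hχS : ∀ p, χ p ≠ 0 → blockOf (L ^ kk) (cvM d L mv kk hL) p.1 ∈ S)
    (hS' : ∀ y κ, (y ∈ S ∨ y + unitVec (cvM d L mv kk hL) κ ∈ S) → y ∈ S' ∧ y + unitVec (cvM d L mv kk hL) κ ∈ S')
    (hUU' : ∀ μ (p : CvX d L mv kk hL), blockOf (L ^ kk) (cvM d L mv kk hL) p.1 ∈ S' → U μ p = U' μ p) :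
    cvNVq d L mv kk hL a ι e U ∘ₗ mulOp (fun q : CvX d L mv kk hL × ι => χ q.1) = cvNVq d L mv kk hL a ι e U' ∘ₗ mulOp (fun q : CvX d L mv kk hL × ι => χ q.1) := by
  have hT : ∀ μ (p : CvX d L mv kk hL), blockOf (L ^ kk) (cvM d L mv kk hL) p.1 ∈ S' → cvT e U μ p = cvT e U' μ p := fun μ p hp => by
    simp only [cvT, hUU' μ p hp]
  rw [cvNVq, cvNVq, LinearMap.smul_comp, LinearMap.smul_comp, LinearMap.sub_comp, LinearMap.sub_comp,
    qvCovAdj_comp_qvCov_comp_mulOp_congr (cvM d L mv kk hL) (L ^ kk) hχS hS' hT]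

/-- ★★★ **THE ROW OF `N_V^Q` BEHIND A CUT FROM BOX-LOCAL TRANSPORTER LETTERS** (n15-c∕`cv_hasMaj_sandwich_cvNVq` localised): for cuts `|f|, |χ| ≤ 1` with `B(supp χ) ⊆ S` and
`S ∪ (S ± e_κ) ⊆ S′` stepwise, IF `rows∕cols(coordMat e Ad_{U_μ(p)} − 1) ≤ ρ` at the bond points `p` with `B(p) ∈ S′` (nothing asked elsewhere), THEN
`M_f∘N_V^Q(U)∘M_χ ≤ |a|K(2+K)·c_δe^{3δ}·e^{−δd}`, `K = (1+ρ)^{(d+2)L^k} − 1` (the global lemma at the field extended by `𝟙` off `S′`).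
[cite: Balaban1985BackgroundPropagators, (3.26) p.395, (3.35) p.396, (3.59)–(3.60) p.402, Cor. 3.8 p.410 (mechanism)] -/
theorem cv_hasMaj_sandwich_cvNVq_local {U : Fin (d + 1) → CvX d L mv kk hL → Matrix mm mm ℂ} {ρ δ : ℝ} (hρ : 0 ≤ ρ) (hδ : 0 < δ)
    {S S' : Finset (Tor (cvM d L mv kk hL))} (hS' : ∀ y κ, (y ∈ S ∨ y + unitVec (cvM d L mv kk hL) κ ∈ S) → y ∈ S' ∧ y + unitVec (cvM d L mv kk hL) κ ∈ S')
    (hTr : ∀ μ (p : CvX d L mv kk hL), blockOf (L ^ kk) (cvM d L mv kk hL) p.1 ∈ S' → ∀ i, ∑ j, |(cvT e U μ p - 1) i j| ≤ ρ)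
    (hTc : ∀ μ (p : CvX d L mv kk hL), blockOf (L ^ kk) (cvM d L mv kk hL) p.1 ∈ S' → ∀ j, ∑ i, |(cvT e U μ p - 1) i j| ≤ ρ)
    (f χ : CvX d L mv kk hL → ℝ) (hf : ∀ x, |f x| ≤ 1) (hχ : ∀ x, |χ x| ≤ 1) (hχS : ∀ p, χ p ≠ 0 → blockOf (L ^ kk) (cvM d L mv kk hL) p.1 ∈ S) :
    HasMaj (CvNorm d L mv kk hL ι) (CvNorm d L mv kk hL ι)
      (mulOp (fun p : CvX d L mv kk hL × ι => f p.1) ∘ₗ cvNVq d L mv kk hL a ι e U ∘ₗ mulOp (fun p : CvX d L mv kk hL × ι => χ p.1))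
      (fun y y' => |a| * (((1 + ρ) ^ ((d + 2) * L ^ kk) - 1) * (2 + ((1 + ρ) ^ ((d + 2) * L ^ kk) - 1)) * (B4Sect5Proof.latticeConst (d + 1) δ * Real.exp (3 * δ))) *
        Real.exp (-(δ * (unitTorusGeo L kk (cvM d L mv kk hL)).dist y y'))) := by
  classical
  -- the field EXTENDED BY `𝟙` off `S′` is globally `ρ`-close to `1`
  let U' : Fin (d + 1) → CvX d L mv kk hL → Matrix mm mm ℂ := fun μ p => if blockOf (L ^ kk) (cvM d L mv kk hL) p.1 ∈ S' then U μ p else 1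
  have hUU' : ∀ μ (p : CvX d L mv kk hL), blockOf (L ^ kk) (cvM d L mv kk hL) p.1 ∈ S' → U μ p = U' μ p := fun μ p hp => by
    simp only [U', if_pos hp]
  have hT' : ∀ μ (p : CvX d L mv kk hL), blockOf (L ^ kk) (cvM d L mv kk hL) p.1 ∉ S' → cvT e U' μ p = 1 := fun μ p hp => by
    simp only [cvT, U', if_neg hp]
    exact CurvedSpecies.coordMat_conj_one e
  have hTr' : ∀ μ (p : CvX d L mv kk hL) i, ∑ j, |(cvT e U' μ p - 1) i j| ≤ ρ := fun μ p i => by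
    by_cases hp : blockOf (L ^ kk) (cvM d L mv kk hL) p.1 ∈ S'
    · have e1 : cvT e U' μ p = cvT e U μ p := by simp only [cvT, U', if_pos hp]
      rw [e1]; exact hTr μ p hp i
    · rw [hT' μ p hp, sub_self]
      simp only [Matrix.zero_apply, abs_zero, Finset.sum_const_zero]
      exact hρ
  have hTc' : ∀ μ (p : CvX d L mv kk hL) j, ∑ i, |(cvT e U' μ p - 1) i j| ≤ ρ := fun μ p j => by
    by_cases hp : blockOf (L ^ kk) (cvM d L mv kk hL) p.1 ∈ S'
    · have e1 : cvT e U' μ p = cvT e U μ p := by simp only [cvT, U', if_pos hp]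
      rw [e1]; exact hTc μ p hp j
    · rw [hT' μ p hp, sub_self]
      simp only [Matrix.zero_apply, abs_zero, Finset.sum_const_zero]
      exact hρ
  rw [cvNVq_comp_mulOp_congr e mv kk hL a hχS hS' hUU']
  exact cv_hasMaj_sandwich_cvNVq e mv kk hL a hρ hδ hTr' hTc' f χ hf hχ

end Local

end Summit.QuantumFields.YangMills.BalabanUVNodes.N15.Gluing

end
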